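import Mathlib
import HarnessLib

/-!
# Venture HSemireg — COROLLARY M⁺: the window of the sliver OFF THE FLAT LOCUS, for LEVEL-UNIFORM margins (W5 seat w5-n6-2 gen 19)

Bookkeeping of the computation cell `pub-hsemireg`, group W5 (notes `widen/W5/SLIVER-w5n62g18.md` §0–§2 and
§7 (2), `widen/W5/N7-FEASIBILITY-w5n7.md` §3.6 (b) ∕ §3.8 (a), `widen/W5/KERNEL-M-w5n62g19.md` §10; deposit
`widen/W5/n6code2/v22/window/`). The level-uniform analogue of `FlatMomentIdentity.momentM_window_of_design`
(COROLLARY M: `3σ² − (3d − t)σ + d(t − 2d) ≤ 0` on the flat locus). PLAIN; nothing of the tree imported or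
restated. The two identities it consumes enter as HYPOTHESES stated verbatim — `hM` = THEOREM M⁺ (the
conclusion of `UniformMarginMomentIdentity.marginMomentM`) and `hΦ` = the Φ⁺-law (the conclusion of
`UniformMarginPhiLaw.phi_law_of_fourSet`, itself the `|S| = 4` class equation of N7F §3.8 (a) rewritten) —
exactly as THEOREM M entered `FlatMomentWindow.momentM_window` before `FlatMomentIdentity` discharged it;
with those two files in the tree the discharge is two `exact`s.

SETTING. Four finite level types `A, B, C, D`, scalars `tA … tD` (the level counts), margin functions
`μ_X`, a parameter pair `(m, s)`, six `0 ∕ 1` torus matrices over an ordered field; `p_X = Σ μ_X²`,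
`C_X = Σ μ_X³`, `B_XY = Σ μ_X·xXY·μ_Y`, `T_XYZ` the triangle sums, `ΣPaw` the twelve weighted triangle sums,
`e₁(t) = tA + tB + tC + tD`. The level-uniform line sums (LEVEL-UNIFORM margins, N7F §3.6 (a)) are not
assumed as such: they enter only through `hM` and `hΦ`, whose discharging theorems assume them, so the
corollary is stated with exactly the hypotheses its proof uses.

* `marginWindow_of_momentM_of_phiLaw` — **COROLLARY M⁺**: the four TRIANGLE LAWS `T_XYZ = p_X + p_Y +
  p_Z + m s` (N7F §3.6 (b), the `|S| = 3` class equations), `hΦ` and `hM` give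
  `0 ≤ 36 ΣB + 33 ΣC − 15 ΣPaw − 2 Σ_X (Σ_{W≠X} t_W)·p_X − 3 m s·e₁(t) − 24 m² − 36 m s²`.
  Proof: the right side equals `[P] + 4[Q] + 16[ΣpM]` summed over transversals (THEOREM M⁺'s left side
  minus `18·(K₄ − ΣpM)`, the triangle sums eliminated by the laws — one `linear_combination`), and every
  exact-class indicator is `≥ 0` for `0 ∕ 1` entries. CHECK at `μ ≡ d`, `t_X = t` (`B = C = t d³`,
  `ΣPaw = 12 t d² σ`, `m = t d`, `s = σ − 3d`): the right side is `12 t d·((3d − t)σ − 3σ² − d(t − 2d))`,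
  i.e. COROLLARY M's window times `12 t d > 0`.

HONEST FRAMING: finite sums and ordered-field arithmetic only; a NECESSARY condition on the free moments
`ΣB, ΣC, ΣPaw, p_X` of a four-coordinate `0 ∕ 1` design with level-uniform margins satisfying the quoted
class equations — no census, no verdict. Nothing in this file says that HC, HC_CM or HC_AV holds; no door ∕
tier ∕ report sentence of the cell is a consequence of this file alone.
-/

namespace Summit.Ventures.HSemireg
namespace UniformMarginWindow
open Finset

variable {F : Type*} [Field F] [LinearOrder F] [IsStrictOrderedRing F]
variable {A B C D : Type*} [Fintype A] [Fintype B] [Fintype C] [Fintype D]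

/-- **COROLLARY M⁺ — the window off the flat locus, conditional on THEOREM M⁺ (`hM`) and the Φ⁺-law
(`hΦ`).** Six `0 ∕ 1` matrices over an ordered field between four finite level types, scalars `tA … tD`,
margin functions `μA … μD`, a parameter pair `(m, s)`. Hypotheses: the four TRIANGLE LAWS
`T_XYZ = p_X + p_Y + p_Z + m s` (N7F §3.6 (b)); `hΦ` = `K₄ − ΣpM = m² + 2 m s² − 2ΣB − 2ΣC + ΣPaw`
(`UniformMarginPhiLaw.phi_law_of_fourSet`); `hM` = THEOREM M⁺ (`UniformMarginMomentIdentity.marginMomentM`).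
Conclusion: `0 ≤ 36 ΣB + 33 ΣC − 15 ΣPaw − 2 Σ_X (Σ_{W≠X} t_W)·p_X − 3 m s (tA + tB + tC + tD) − 24 m²
− 36 m s²` (it is `P + 4Q + 16 ΣpM ≥ 0`). -/
theorem marginWindow_of_momentM_of_phiLaw (tA tB tC tD m s : F)
    (μA : A → F) (μB : B → F) (μC : C → F) (μD : D → F)
    (xAB : A → B → F) (xAC : A → C → F) (xAD : A → D → F)
    (xBC : B → C → F) (xBD : B → D → F) (xCD : C → D → F)
    (zAB : ∀ a b, xAB a b = 0 ∨ xAB a b = 1) (zAC : ∀ a c, xAC a c = 0 ∨ xAC a c = 1)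
    (zAD : ∀ a e, xAD a e = 0 ∨ xAD a e = 1) (zBC : ∀ b c, xBC b c = 0 ∨ xBC b c = 1)
    (zBD : ∀ b e, xBD b e = 0 ∨ xBD b e = 1) (zCD : ∀ c e, xCD c e = 0 ∨ xCD c e = 1)
    (hTABC : (∑ a, ∑ b, ∑ c, xAB a b * xAC a c * xBC b c)
      = (∑ a, μA a * μA a) + (∑ b, μB b * μB b) + (∑ c, μC c * μC c) + m * s)
    (hTABD : (∑ a, ∑ b, ∑ e, xAB a b * xAD a e * xBD b e)
      = (∑ a, μA a * μA a) + (∑ b, μB b * μB b) + (∑ e, μD e * μD e) + m * s)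
    (hTACD : (∑ a, ∑ c, ∑ e, xAC a c * xAD a e * xCD c e)
      = (∑ a, μA a * μA a) + (∑ c, μC c * μC c) + (∑ e, μD e * μD e) + m * s)
    (hTBCD : (∑ b, ∑ c, ∑ e, xBC b c * xBD b e * xCD c e)
      = (∑ b, μB b * μB b) + (∑ c, μC c * μC c) + (∑ e, μD e * μD e) + m * s)
    (hΦ : (∑ a, ∑ b, ∑ c, ∑ e, xAB a b * xAC a c * xAD a e * xBC b c * xBD b e * xCD c e)
      - (∑ a, ∑ b, ∑ c, ∑ e,
          (xAB a b * xCD c e * (1 - xAC a c) * (1 - xAD a e) * (1 - xBC b c) * (1 - xBD b e)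
          + xAC a c * xBD b e * (1 - xAB a b) * (1 - xAD a e) * (1 - xBC b c) * (1 - xCD c e)
          + xAD a e * xBC b c * (1 - xAB a b) * (1 - xAC a c) * (1 - xBD b e) * (1 - xCD c e)))
      = m ^ 2 + 2 * m * s ^ 2
        - 2 * ((∑ a, ∑ b, μA a * xAB a b * μB b) + (∑ a, ∑ c, μA a * xAC a c * μC c)
          + (∑ a, ∑ e, μA a * xAD a e * μD e) + (∑ b, ∑ c, μB b * xBC b c * μC c)
          + (∑ b, ∑ e, μB b * xBD b e * μD e) + (∑ c, ∑ e, μC c * xCD c e * μD e))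
        - 2 * ((∑ a, μA a * μA a * μA a) + (∑ b, μB b * μB b * μB b)
          + (∑ c, μC c * μC c * μC c) + (∑ e, μD e * μD e * μD e))
        + ((∑ a, (∑ b, ∑ c, xAB a b * xAC a c * xBC b c) * μA a)
          + (∑ a, ∑ b, (∑ c, xAB a b * xAC a c * xBC b c) * μB b)
          + (∑ a, ∑ b, ∑ c, xAB a b * xAC a c * xBC b c * μC c)
          + (∑ a, (∑ b, ∑ e, xAB a b * xAD a e * xBD b e) * μA a)
          + (∑ a, ∑ b, (∑ e, xAB a b * xAD a e * xBD b e) * μB b)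
          + (∑ a, ∑ b, ∑ e, xAB a b * xAD a e * xBD b e * μD e)
          + (∑ a, (∑ c, ∑ e, xAC a c * xAD a e * xCD c e) * μA a)
          + (∑ a, ∑ c, (∑ e, xAC a c * xAD a e * xCD c e) * μC c)
          + (∑ a, ∑ c, ∑ e, xAC a c * xAD a e * xCD c e * μD e)
          + (∑ b, (∑ c, ∑ e, xBC b c * xBD b e * xCD c e) * μB b)
          + (∑ b, ∑ c, (∑ e, xBC b c * xBD b e * xCD c e) * μC c)
          + (∑ b, ∑ c, ∑ e, xBC b c * xBD b e * xCD c e * μD e)))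
    (hM : ∑ a, ∑ b, ∑ c, ∑ e,
      (18 * (xAB a b * xAC a c * xAD a e * xBC b c * xBD b e * xCD c e)
      + (xAB a b * xAC a c * (1 - xAD a e) * (1 - xBC b c) * (1 - xBD b e) * (1 - xCD c e)
          + xAB a b * xAD a e * (1 - xAC a c) * (1 - xBC b c) * (1 - xBD b e) * (1 - xCD c e)
          + xAB a b * xBC b c * (1 - xAC a c) * (1 - xAD a e) * (1 - xBD b e) * (1 - xCD c e)
          + xAB a b * xBD b e * (1 - xAC a c) * (1 - xAD a e) * (1 - xBC b c) * (1 - xCD c e)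
          + xAC a c * xAD a e * (1 - xAB a b) * (1 - xBC b c) * (1 - xBD b e) * (1 - xCD c e)
          + xAC a c * xBC b c * (1 - xAB a b) * (1 - xAD a e) * (1 - xBD b e) * (1 - xCD c e)
          + xAC a c * xCD c e * (1 - xAB a b) * (1 - xAD a e) * (1 - xBC b c) * (1 - xBD b e)
          + xAD a e * xBD b e * (1 - xAB a b) * (1 - xAC a c) * (1 - xBC b c) * (1 - xCD c e)
          + xAD a e * xCD c e * (1 - xAB a b) * (1 - xAC a c) * (1 - xBC b c) * (1 - xBD b e)
          + xBC b c * xBD b e * (1 - xAB a b) * (1 - xAC a c) * (1 - xAD a e) * (1 - xCD c e)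
          + xBC b c * xCD c e * (1 - xAB a b) * (1 - xAC a c) * (1 - xAD a e) * (1 - xBD b e)
          + xBD b e * xCD c e * (1 - xAB a b) * (1 - xAC a c) * (1 - xAD a e) * (1 - xBC b c))
      + 4 * (xAB a b * xAC a c * xAD a e * xBC b c * xBD b e * (1 - xCD c e)
          + xAB a b * xAC a c * xAD a e * xBC b c * xCD c e * (1 - xBD b e)
          + xAB a b * xAC a c * xAD a e * xBD b e * xCD c e * (1 - xBC b c)
          + xAB a b * xAC a c * xBC b c * xBD b e * xCD c e * (1 - xAD a e)
          + xAB a b * xAD a e * xBC b c * xBD b e * xCD c e * (1 - xAC a c)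
          + xAC a c * xAD a e * xBC b c * xBD b e * xCD c e * (1 - xAB a b))
      - 2 * (xAB a b * xCD c e * (1 - xAC a c) * (1 - xAD a e) * (1 - xBC b c) * (1 - xBD b e)
          + xAC a c * xBD b e * (1 - xAB a b) * (1 - xAD a e) * (1 - xBC b c) * (1 - xCD c e)
          + xAD a e * xBC b c * (1 - xAB a b) * (1 - xAC a c) * (1 - xBD b e) * (1 - xCD c e)))
      = ((tB + tC + tD) * (∑ a, μA a * μA a) + (tA + tC + tD) * (∑ b, μB b * μB b)
          + (tA + tB + tD) * (∑ c, μC c * μC c) + (tA + tB + tC) * (∑ e, μD e * μD e))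
        - 6 * m ^ 2
        - 3 * (tD * (∑ a, ∑ b, ∑ c, xAB a b * xAC a c * xBC b c)
          + tC * (∑ a, ∑ b, ∑ e, xAB a b * xAD a e * xBD b e)
          + tB * (∑ a, ∑ c, ∑ e, xAC a c * xAD a e * xCD c e)
          + tA * (∑ b, ∑ c, ∑ e, xBC b c * xBD b e * xCD c e))
        - 3 * ((∑ a, μA a * μA a * μA a) + (∑ b, μB b * μB b * μB b)
          + (∑ c, μC c * μC c * μC c) + (∑ e, μD e * μD e * μD e))
        + 3 * ((∑ a, (∑ b, ∑ c, xAB a b * xAC a c * xBC b c) * μA a)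
          + (∑ a, ∑ b, (∑ c, xAB a b * xAC a c * xBC b c) * μB b)
          + (∑ a, ∑ b, ∑ c, xAB a b * xAC a c * xBC b c * μC c)
          + (∑ a, (∑ b, ∑ e, xAB a b * xAD a e * xBD b e) * μA a)
          + (∑ a, ∑ b, (∑ e, xAB a b * xAD a e * xBD b e) * μB b)
          + (∑ a, ∑ b, ∑ e, xAB a b * xAD a e * xBD b e * μD e)
          + (∑ a, (∑ c, ∑ e, xAC a c * xAD a e * xCD c e) * μA a)
          + (∑ a, ∑ c, (∑ e, xAC a c * xAD a e * xCD c e) * μC c)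
          + (∑ a, ∑ c, ∑ e, xAC a c * xAD a e * xCD c e * μD e)
          + (∑ b, (∑ c, ∑ e, xBC b c * xBD b e * xCD c e) * μB b)
          + (∑ b, ∑ c, (∑ e, xBC b c * xBD b e * xCD c e) * μC c)
          + (∑ b, ∑ c, ∑ e, xBC b c * xBD b e * xCD c e * μD e))) :
    0 ≤ 36 * ((∑ a, ∑ b, μA a * xAB a b * μB b) + (∑ a, ∑ c, μA a * xAC a c * μC c)
          + (∑ a, ∑ e, μA a * xAD a e * μD e) + (∑ b, ∑ c, μB b * xBC b c * μC c)
          + (∑ b, ∑ e, μB b * xBD b e * μD e) + (∑ c, ∑ e, μC c * xCD c e * μD e))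
        + 33 * ((∑ a, μA a * μA a * μA a) + (∑ b, μB b * μB b * μB b)
          + (∑ c, μC c * μC c * μC c) + (∑ e, μD e * μD e * μD e))
        - 15 * ((∑ a, (∑ b, ∑ c, xAB a b * xAC a c * xBC b c) * μA a)
          + (∑ a, ∑ b, (∑ c, xAB a b * xAC a c * xBC b c) * μB b)
          + (∑ a, ∑ b, ∑ c, xAB a b * xAC a c * xBC b c * μC c)
          + (∑ a, (∑ b, ∑ e, xAB a b * xAD a e * xBD b e) * μA a)
          + (∑ a, ∑ b, (∑ e, xAB a b * xAD a e * xBD b e) * μB b)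
          + (∑ a, ∑ b, ∑ e, xAB a b * xAD a e * xBD b e * μD e)
          + (∑ a, (∑ c, ∑ e, xAC a c * xAD a e * xCD c e) * μA a)
          + (∑ a, ∑ c, (∑ e, xAC a c * xAD a e * xCD c e) * μC c)
          + (∑ a, ∑ c, ∑ e, xAC a c * xAD a e * xCD c e * μD e)
          + (∑ b, (∑ c, ∑ e, xBC b c * xBD b e * xCD c e) * μB b)
          + (∑ b, ∑ c, (∑ e, xBC b c * xBD b e * xCD c e) * μC c)
          + (∑ b, ∑ c, ∑ e, xBC b c * xBD b e * xCD c e * μD e))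
        - 2 * ((tB + tC + tD) * (∑ a, μA a * μA a) + (tA + tC + tD) * (∑ b, μB b * μB b)
          + (tA + tB + tD) * (∑ c, μC c * μC c) + (tA + tB + tC) * (∑ e, μD e * μD e))
        - 3 * m * s * (tA + tB + tC + tD) - 24 * m ^ 2 - 36 * m * s ^ 2 := by
  -- non-negativity of a `0 ∕ 1` entry and of its complement (local; nothing of the tree restated)
  have h01 : ∀ {x : F}, x = 0 ∨ x = 1 → 0 ≤ x := by
    rintro x (rfl | rfl) <;> norm_num
  have h01' : ∀ {x : F}, x = 0 ∨ x = 1 → 0 ≤ 1 - x := by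
    rintro x (rfl | rfl) <;> norm_num
  -- `[P] + 4[Q] + 16[ΣpM] ≥ 0`: THEOREM M⁺'s left side minus `18·(K₄ − ΣpM)` is ONE transversal sum of
  -- exact-class indicators with positive coefficients
  have hN : 0 ≤ (∑ a, ∑ b, ∑ c, ∑ e,
      (18 * (xAB a b * xAC a c * xAD a e * xBC b c * xBD b e * xCD c e)
      + (xAB a b * xAC a c * (1 - xAD a e) * (1 - xBC b c) * (1 - xBD b e) * (1 - xCD c e)
          + xAB a b * xAD a e * (1 - xAC a c) * (1 - xBC b c) * (1 - xBD b e) * (1 - xCD c e)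
          + xAB a b * xBC b c * (1 - xAC a c) * (1 - xAD a e) * (1 - xBD b e) * (1 - xCD c e)
          + xAB a b * xBD b e * (1 - xAC a c) * (1 - xAD a e) * (1 - xBC b c) * (1 - xCD c e)
          + xAC a c * xAD a e * (1 - xAB a b) * (1 - xBC b c) * (1 - xBD b e) * (1 - xCD c e)
          + xAC a c * xBC b c * (1 - xAB a b) * (1 - xAD a e) * (1 - xBD b e) * (1 - xCD c e)
          + xAC a c * xCD c e * (1 - xAB a b) * (1 - xAD a e) * (1 - xBC b c) * (1 - xBD b e)
          + xAD a e * xBD b e * (1 - xAB a b) * (1 - xAC a c) * (1 - xBC b c) * (1 - xCD c e)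
          + xAD a e * xCD c e * (1 - xAB a b) * (1 - xAC a c) * (1 - xBC b c) * (1 - xBD b e)
          + xBC b c * xBD b e * (1 - xAB a b) * (1 - xAC a c) * (1 - xAD a e) * (1 - xCD c e)
          + xBC b c * xCD c e * (1 - xAB a b) * (1 - xAC a c) * (1 - xAD a e) * (1 - xBD b e)
          + xBD b e * xCD c e * (1 - xAB a b) * (1 - xAC a c) * (1 - xAD a e) * (1 - xBC b c))
      + 4 * (xAB a b * xAC a c * xAD a e * xBC b c * xBD b e * (1 - xCD c e)
          + xAB a b * xAC a c * xAD a e * xBC b c * xCD c e * (1 - xBD b e)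
          + xAB a b * xAC a c * xAD a e * xBD b e * xCD c e * (1 - xBC b c)
          + xAB a b * xAC a c * xBC b c * xBD b e * xCD c e * (1 - xAD a e)
          + xAB a b * xAD a e * xBC b c * xBD b e * xCD c e * (1 - xAC a c)
          + xAC a c * xAD a e * xBC b c * xBD b e * xCD c e * (1 - xAB a b))
      - 2 * (xAB a b * xCD c e * (1 - xAC a c) * (1 - xAD a e) * (1 - xBC b c) * (1 - xBD b e)
          + xAC a c * xBD b e * (1 - xAB a b) * (1 - xAD a e) * (1 - xBC b c) * (1 - xCD c e)
          + xAD a e * xBC b c * (1 - xAB a b) * (1 - xAC a c) * (1 - xBD b e) * (1 - xCD c e))))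
      - 18 * ((∑ a, ∑ b, ∑ c, ∑ e, xAB a b * xAC a c * xAD a e * xBC b c * xBD b e * xCD c e)
        - (∑ a, ∑ b, ∑ c, ∑ e,
          (xAB a b * xCD c e * (1 - xAC a c) * (1 - xAD a e) * (1 - xBC b c) * (1 - xBD b e)
          + xAC a c * xBD b e * (1 - xAB a b) * (1 - xAD a e) * (1 - xBC b c) * (1 - xCD c e)
          + xAD a e * xBC b c * (1 - xAB a b) * (1 - xAC a c) * (1 - xBD b e) * (1 - xCD c e)))) := by
    simp only [mul_sum, ← sum_sub_distrib]
    refine sum_nonneg fun a _ => sum_nonneg fun b _ => sum_nonneg fun c _ =>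
      sum_nonneg fun e _ => ?_
    have h1 := zAB a b; have h2 := zAC a c; have h3 := zAD a e
    have h4 := zBC b c; have h5 := zBD b e; have h6 := zCD c e
    have hP : 0 ≤ (xAB a b * xAC a c * (1 - xAD a e) * (1 - xBC b c) * (1 - xBD b e) * (1 - xCD c e)
          + xAB a b * xAD a e * (1 - xAC a c) * (1 - xBC b c) * (1 - xBD b e) * (1 - xCD c e)
          + xAB a b * xBC b c * (1 - xAC a c) * (1 - xAD a e) * (1 - xBD b e) * (1 - xCD c e)
          + xAB a b * xBD b e * (1 - xAC a c) * (1 - xAD a e) * (1 - xBC b c) * (1 - xCD c e)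
          + xAC a c * xAD a e * (1 - xAB a b) * (1 - xBC b c) * (1 - xBD b e) * (1 - xCD c e)
          + xAC a c * xBC b c * (1 - xAB a b) * (1 - xAD a e) * (1 - xBD b e) * (1 - xCD c e)
          + xAC a c * xCD c e * (1 - xAB a b) * (1 - xAD a e) * (1 - xBC b c) * (1 - xBD b e)
          + xAD a e * xBD b e * (1 - xAB a b) * (1 - xAC a c) * (1 - xBC b c) * (1 - xCD c e)
          + xAD a e * xCD c e * (1 - xAB a b) * (1 - xAC a c) * (1 - xBC b c) * (1 - xBD b e)
          + xBC b c * xBD b e * (1 - xAB a b) * (1 - xAC a c) * (1 - xAD a e) * (1 - xCD c e)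
          + xBC b c * xCD c e * (1 - xAB a b) * (1 - xAC a c) * (1 - xAD a e) * (1 - xBD b e)
          + xBD b e * xCD c e * (1 - xAB a b) * (1 - xAC a c) * (1 - xAD a e) * (1 - xBC b c))
        + 4 * (xAB a b * xAC a c * xAD a e * xBC b c * xBD b e * (1 - xCD c e)
          + xAB a b * xAC a c * xAD a e * xBC b c * xCD c e * (1 - xBD b e)
          + xAB a b * xAC a c * xAD a e * xBD b e * xCD c e * (1 - xBC b c)
          + xAB a b * xAC a c * xBC b c * xBD b e * xCD c e * (1 - xAD a e)
          + xAB a b * xAD a e * xBC b c * xBD b e * xCD c e * (1 - xAC a c)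
          + xAC a c * xAD a e * xBC b c * xBD b e * xCD c e * (1 - xAB a b))
        + 16 * (xAB a b * xCD c e * (1 - xAC a c) * (1 - xAD a e) * (1 - xBC b c) * (1 - xBD b e)
          + xAC a c * xBD b e * (1 - xAB a b) * (1 - xAD a e) * (1 - xBC b c) * (1 - xCD c e)
          + xAD a e * xBC b c * (1 - xAB a b) * (1 - xAC a c) * (1 - xBD b e) * (1 - xCD c e)) := by
      repeat (first
        | refine add_nonneg ?_ ?_
        | refine mul_nonneg ?_ ?_
        | exact h01' ‹_›
        | exact h01 ‹_›
        | norm_num)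
    linear_combination hP
  -- eliminate `K₄` by the Φ⁺-law and the triangle sums by the triangle laws
  linear_combination hN + hM - 18 * hΦ - 3 * tD * hTABC - 3 * tC * hTABD - 3 * tB * hTACD
    - 3 * tA * hTBCD

end UniformMarginWindow
end Summit.Ventures.HSemireg
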